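import Literature.Algebra.Lie.LefschetzModuleLefschetzInvolution
import HarnessLib

/-!
# The Hodge involution `*_H` of a Lefschetz module, constructed (André 1996, §1.1–1.2; Kleiman 1968, 1.4.2; Milne 1999, p. 664 `∗`)

Topic `Literature/Algebra/Lie` (namespace `Literature.Algebra.Lie`).  Lane `lit-hodgefound` (Track 2 foundations library),
prover seat `lit-hodgefound-p34` (generation 29, row g29-#3), the sequel of `LefschetzModuleLefschetzInvolution.lean` (g29-#2:
the constructed Lefschetz involution `*_L = HasLefschetzProperty.lefschetzInvolution`) and of `LefschetzModuleStringReversal.lean`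
(row A1-88's sequel of seat `lit-hodgefound-skel-1`: `IsStringReversal`, the string position / co-position projectors
`eⁱNⁱ − eⁱ⁺¹Nⁱ⁺¹`, `Nᵗeᵗ − Nᵗ⁺¹eᵗ⁺¹` with `N = *_L e *_L`).  DEFINITIONS WITH BODIES (`hodgeSign`,
`HasLefschetzProperty.hodgeInvolution`) and PROVED theorems only (no named fact, no `sorry`, no instance, no notation; D-0026 net
debt `0`).

## Sources, VERBATIM

Y. André, *Pour une théorie inconditionnelle des motifs*, Publ. Math. IHÉS **83** (1996) [Andre1996Motifs] (held
`paper:doi-10-1007-bf02698643`), §1.1 (p. 10 = p0007 L33–L40): "si `x = Σ Lᵏ x_{j-2k}` est la décomposition de Lefschetz de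
`x ∈ Hʲ(X)` […] On définit aussi les involutions de Lefschetz et de Hodge respectivement par les formules :
`*_L x = Σ L^{d-j+k} x_{j-2k}`, `*_H x = Σ (-1)^{(j-2k)(j-2k+1)/2} L^{d-j+k} x_{j-2k}`"; (p. 11 = p0008 L3–L14): "le point important,
qui justifie l'introduction de `*_H` est que cet opérateur star et `*_H` ont les mêmes propriétés de positivité sur les cycles
réels de type `(p,p)`. On voit immédiatement que `Pʲ(X) = Hʲ(X) ∩ Ker *_L L *_L` et que l'opérateur `*_L L *_L = *_H L *_H`,
proportionnel à `ᶜΛ` sur chaque composante de Lefschetz, est un inverse à droite de `L` sur l'image de `L`"; Prop. 1.2 (p. 11):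
"Les sous-algèbres `ℚ[L, *_L]`, `ℚ[L, *_H]`, `ℚ[L, *_L L *_L]`, `ℚ[L, ᶜΛ]` de `End H*(X)` sont égales et contiennent les
projecteurs de Künneth."
J. S. Milne, *Lefschetz classes on abelian varieties*, Duke Math. J. **96** (1999) [Milne1999LefschetzClasses], p. 664: "For
`x = Σ Lⁱ xᵢ ∈ Hˢ(X)`, define […] `*x = Σ_{i ≥ s-d, 0} (-1)^{(s-2i)(s-2i+1)/2} L^{d-s+i} xᵢ`"; Thm. 5.9 and its proof (p. 665):
"all elements of the `ℚ`-algebra `ℚ[L, Λ]` are Lefschetz. Since this algebra contains `ᶜΛ` and `∗` (Kleiman 1968, 1.4.4)".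
S. L. Kleiman, *Algebraic cycles and the Weil conjectures* (1968) [Kleiman1968AlgebraicCycles], §1.4 (1.4.2: the involution `⋆`
with `⋆(Lʲ x) = (-1)^{i(i+1)/2} L^{n-i-j} x` for `x ∈ Pⁱ`, so that `Λ = ⋆ L ⋆`; 1.4.4) — as cited by André and Milne.

**ERRATUM (row g31-#1 of the same seat, 2026-08-27) — attribution of the display, no statement changed.**  The held text of André's
paper is the OCR layer of a CCITT scan and its displayed formulas are garbled.  André's display for `*_H` (p. 10) actually carries a
FACTOR: `*_H x = Σ (-1)^{(j-2k)(j-2k+1)/2} (k!/(d-j+k)!) L^{d-j+k} x_{j-2k}` — readable fragments `k!`, a fraction bar, `(d-j+k)!`, and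
forced by André's two printed consequences "l'élément `(0 1 ; -1 0)` de `SL₂` s'envoie sur `± *_H`" (§1.2, p. 11) and
"`*_H x ⊗ *_H y = (-1)^{ij} *_H (x ⊗ y)`" (Lemme 1.3.2, p. 13), both of which FAIL without the factor; and the sentence of p. 11 quoted
above DEFINES `ᶜL := *_L L *_L` ("l'opérateur `ᶜL = *_L L *_L`, proportionnel à `ᶜΛ` […]") rather than asserting
`*_L L *_L = *_H L *_H`.  Consequently the factorial-free operator `hodgeInvolution` constructed in THIS file is KLEIMAN'S `⋆`
(1968, 1.4.2) = MILNE'S `∗` (1999, p. 664) — for which every theorem below holds as proved, and for which André's Prop. 1.2 algebra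
statements hold verbatim as well —, whereas ANDRÉ'S OWN `*_H` is `HasLefschetzProperty.andreHodgeInvolution` of
`LefschetzModuleWeylOperator.lean` (row g31-#1): `*_H (eʲ p) = (j!/(k-j)!) · ⋆(eʲ p)`, `*_H L *_H = ᶜΛ` exactly, `*_H = (-1)^{d + C(n,2)} w`
on `Hⁿ` for the Weyl operator `w = exp(ᶜΛ) exp(-L) exp(ᶜΛ)`.  The same dropped factor occurs in the André quotations of the sibling
files `LefschetzModuleLefschetzInvolution.lean` (g29-#2) and `Motives/HodgeStructureExteriorAlgebraLefschetzInvolution.lean` (g29-#4,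
`hodgeStar` = `∗`); read "André's `*_H`" there as "Kleiman's `⋆` / Milne's `∗`".

## Rendering (dictionary)

On the string `p, e p, …, eᵏ p` through `p ∈ P_{-k}` (a primitive class `x_i` of cohomological degree `i = d - k`, `d = dim X`;
A1-88's grading `M_m = H^{m+d}`), André's `*_H` is `*_L` followed by the SIGN `(-1)^{i(i+1)/2} = (-1)^{(d-k)(d-k+1)/2}`, constant
along the string.  The operator acting by that sign on every string of length `k + 1` is written, as in
`LefschetzModuleStringReversal` §4 (Kleiman's polynomial), as a non-commutative polynomial in `e` and `N = s e s`
(`s` a string reversal): **`hodgeSign e s d D = Σ_{i,t ≤ D} (-1)^{(d-(i+t))(d-(i+t)+1)/2} (eⁱNⁱ − eⁱ⁺¹Nⁱ⁺¹)(Nᵗeᵗ − Nᵗ⁺¹eᵗ⁺¹)`** — on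
`eʲ p` only `(i, t) = (j, k - j)` survives (`hodgeSign_apply_pow_primitive`).  Then **`*_H := *_L ∘ hodgeSign`**
(`HasLefschetzProperty.hodgeInvolution L hgr d`, with `s = *_L` constructed in g29-#2 and `D = dim M`, beyond which all strings
vanish).  The parameter `d : ℕ` is André's `d = dim X` (the shift `H* = M[d]`; for a Lefschetz module of depth `n`, `d = n`); for
`k ≤ d` the natural-number expression `(d - k) * (d - k + 1) / 2` is the printed exponent `i(i+1)/2`, `i = d - k` (and `P_{-k} = 0`
for `k > depth`).

## Contents (all proved; `s = *_L`, `J = hodgeSign`, `*_H = s J`)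

* §1 `hodgeSign`, `hodgeSign_mem_adjoin` (`J ∈ K[e, N]`), **`IsStringReversal.hodgeSign_apply_pow_primitive`** (`J (eʲ p) = ε • eʲ p`,
  `ε = (-1)^{(d-k)(d-k+1)/2}`), `neg_one_pow_mul_self` (`ε² = 1`).
* §2 `hodgeInvolution`, **`hodgeInvolution_apply_pow_primitive`** (THE PRINTED FORMULA: `*_H (eʲ p) = ε • e^{k-j} p`, i.e.
  `*_H (Lʳ x_i) = (-1)^{i(i+1)/2} L^{d-i-r} x_i`), `hodgeInvolution_apply_primitive`, **`hodgeInvolution_mul_self`** (`*_H² = 1`,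
  "involution"), **`hodgeInvolution_mul_mul_hodgeInvolution_eq`** ("`*_L L *_L = *_H L *_H`"), **`hodgeInvolution_mem_adjoin`**
  (`*_H ∈ K[e, *_L]`: "`ℚ[L, *_H] ⊆ ℚ[L, *_L]`" of Prop. 1.2 / Milne's "this algebra contains `∗`"), `mul_hodgeInvolution_eq_neg`
  (`h *_H = -*_H h`), `hodgeInvolution_apply_mem` (`*_H : M_m → M_{-m}`), `commute_of_mem_adjoin_pair`,
  **`commute_hodgeInvolution`** (an operator commuting with `h` and `e` commutes with `*_H` — Milne's Thm. 5.9 mechanism for `∗`),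
  `dual_mem_adjoin_hodgeInvolution_conj` (`ᶜΛ ∈ K[e, *_H e *_H]`).

## SCOPE (not formalised here)

The positivity sentence ("les mêmes propriétés de positivité sur les cycles réels de type `(p,p)`") needs a polarization and is the
business of the Hodge-structure carriers; the reverse inclusions of Prop. 1.2 (`*_L ∈ ℚ[L, *_H]`, `*_L ∈ ℚ[L, ᶜΛ]` — Kleiman 1.4.5),
the Künneth projectors and the matrix-algebra structure are not formalised here.  Twins on concrete carriers, BY NAME (RULING 29,
nothing restated): Kleiman's `⋆` on the `WeilCohomology` model (`AlgebraicGeometry/Motives/Lefschetz.lean`: `IsLefschetzStar`,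
`LefschetzStarProofs.lean`: `starOp`, `signOp`).

## References

* [Andre1996Motifs] Y. André, *Pour une théorie inconditionnelle des motifs*, Publ. Math. IHÉS 83 (1996) 5–49, §1.1–1.2 (pp. 10–11),
  Prop. 1.2.
* [Milne1999LefschetzClasses] J. S. Milne, *Lefschetz classes on abelian varieties*, Duke Math. J. 96 (1999) 639–675, p. 664 (`Λ`,
  `ᶜΛ`, `∗`), Thm. 5.9 (p. 665).
* [Kleiman1968AlgebraicCycles] S. L. Kleiman, *Algebraic cycles and the Weil conjectures*, in: Dix exposés sur la cohomologie des
  schémas (1968) 359–386, §1.4 (1.4.2, 1.4.4).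
-/

noncomputable section

namespace Literature.Algebra.Lie

open Module Function Set
open HasLefschetzProperty (primitiveSpace mem_primitiveSpace_iff)

variable {K : Type*} [Field K] {M : Type*} [AddCommGroup M] [Module K M] {h e : Module.End K M}

/-! ### §1 The sign operator `J`: `(-1)^{(d-k)(d-k+1)/2}` on the strings of length `k + 1`, as a polynomial in `e` and `N = s e s` -/

variable (e) in
/-- **The Hodge sign operator** `J = Σ_{i,t ≤ D} (-1)^{(d-(i+t))(d-(i+t)+1)/2} · (eⁱNⁱ − eⁱ⁺¹Nⁱ⁺¹) ∘ (Nᵗeᵗ − Nᵗ⁺¹eᵗ⁺¹)`, `N = s e s`: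
on the string vector `eʲ p` (`p ∈ P_{-k}`, `k ≤ D`) it is the sign `(-1)^{i(i+1)/2}`, `i = d - k`, of André's `*_H` / Milne's `∗`
on the Lefschetz component `Lʲ x_i`. [cite: Andre1996Motifs, §1.1 (p. 10, definition of *_H)] [cite: Milne1999LefschetzClasses, §5 p. 664 (definition of ∗)] -/
def hodgeSign (s : Module.End K M) (d D : ℕ) : Module.End K M :=
  ∑ i ∈ Finset.range (D + 1), ∑ t ∈ Finset.range (D + 1),
    ((-1 : K) ^ ((d - (i + t)) * (d - (i + t) + 1) / 2)) •
      ((e ^ i * (s * e * s) ^ i - e ^ (i + 1) * (s * e * s) ^ (i + 1)) *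
        ((s * e * s) ^ t * e ^ t - (s * e * s) ^ (t + 1) * e ^ (t + 1)))

/-- `J` lies in the subalgebra generated by `e` and `N = s e s`. [cite: Andre1996Motifs, Prop. 1.2 (p. 11: ℚ[L, *_H] = ℚ[L, *_L L *_L])] -/
theorem hodgeSign_mem_adjoin (s : Module.End K M) (d D : ℕ) :
    hodgeSign e s d D ∈ Algebra.adjoin K ({e, s * e * s} : Set (Module.End K M)) := by
  set A := Algebra.adjoin K ({e, s * e * s} : Set (Module.End K M))
  have he : e ∈ A := Algebra.subset_adjoin (Set.mem_insert _ _)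
  have hN : s * e * s ∈ A := Algebra.subset_adjoin (Set.mem_insert_of_mem _ rfl)
  refine Subalgebra.sum_mem _ fun i _ ↦ Subalgebra.sum_mem _ fun t _ ↦ Subalgebra.smul_mem _ ?_ _
  refine Subalgebra.mul_mem _ (Subalgebra.sub_mem _ ?_ ?_) (Subalgebra.sub_mem _ ?_ ?_)
  · exact Subalgebra.mul_mem _ (Subalgebra.pow_mem _ he _) (Subalgebra.pow_mem _ hN _)
  · exact Subalgebra.mul_mem _ (Subalgebra.pow_mem _ he _) (Subalgebra.pow_mem _ hN _)
  · exact Subalgebra.mul_mem _ (Subalgebra.pow_mem _ hN _) (Subalgebra.pow_mem _ he _)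
  · exact Subalgebra.mul_mem _ (Subalgebra.pow_mem _ hN _) (Subalgebra.pow_mem _ he _)

/-- **`J` on a string: `J (eʲ p) = (-1)^{(d-k)(d-k+1)/2} eʲ p`** for `p ∈ P_{-k}`, `k ≤ D`, `j ≤ k` — the sign of `*_H` on the
Lefschetz component `Lʲ x_{d-k}`, the same along the whole string. [cite: Andre1996Motifs, §1.1 (p. 10)] [cite: Milne1999LefschetzClasses, §5 p. 664] -/
theorem IsStringReversal.hodgeSign_apply_pow_primitive {s : Module.End K M} (hs : IsStringReversal h e s) (d : ℕ)
    {D k : ℕ} (hkD : k ≤ D) {p : M} (hp : p ∈ primitiveSpace h e k) {j : ℕ} (hj : j ≤ k) :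
    hodgeSign e s d D ((e ^ j) p) = ((-1 : K) ^ ((d - k) * (d - k + 1) / 2)) • (e ^ j) p := by
  have hterm : ∀ i t : ℕ,
      (((-1 : K) ^ ((d - (i + t)) * (d - (i + t) + 1) / 2)) •
        ((e ^ i * (s * e * s) ^ i - e ^ (i + 1) * (s * e * s) ^ (i + 1)) *
          ((s * e * s) ^ t * e ^ t - (s * e * s) ^ (t + 1) * e ^ (t + 1)))) ((e ^ j) p) =
        if i = j ∧ j + t = k then ((-1 : K) ^ ((d - (i + t)) * (d - (i + t) + 1) / 2)) • (e ^ j) p else 0 := by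
    intro i t
    rw [LinearMap.smul_apply, Module.End.mul_apply, hs.coposProj_apply hp t j]
    by_cases hjt : j + t = k
    · rw [if_pos hjt, hs.posProj_apply hp i hj]
      by_cases hij : i = j
      · rw [if_pos hij, if_pos ⟨hij, hjt⟩]
      · rw [if_neg hij, smul_zero, if_neg (fun h' ↦ hij h'.1)]
    · rw [if_neg hjt, map_zero, smul_zero, if_neg (fun h' ↦ hjt h'.2)]
  rw [hodgeSign, LinearMap.sum_apply]
  simp_rw [LinearMap.sum_apply, hterm]
  rw [Finset.sum_eq_single j, Finset.sum_eq_single (k - j)]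
  · rw [if_pos ⟨rfl, by omega⟩, show j + (k - j) = k by omega]
  · intro t _ ht
    rw [if_neg (fun h' ↦ ht (by omega))]
  · intro hkj
    exact absurd (Finset.mem_range.2 (by omega)) hkj
  · intro i _ hi
    refine Finset.sum_eq_zero fun t _ ↦ ?_
    rw [if_neg (fun h' ↦ hi h'.1)]
  · intro hjD
    exact absurd (Finset.mem_range.2 (by omega)) hjD

/-- The sign squares to one: `(-1)^n (-1)^n = 1`. [folklore] -/
private theorem neg_one_pow_mul_self (n : ℕ) : ((-1 : K) ^ n) * ((-1 : K) ^ n) = 1 := by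
  rw [← pow_add, ← two_mul, pow_mul, neg_one_sq, one_pow]

/-! ### §2 The Hodge involution `*_H = *_L ∘ J` -/

namespace HasLefschetzProperty

variable [CharZero K] [FiniteDimensional K M]

/-- Strings of length `> dim M` are zero: `P_{-k} = 0` for `k ≥ dim M` (`M_{-k} = 0`, A1-88 §3). [cite: LooijengaLunts1997, §1 (1.1) p. 4 L58–L60 (depth)] -/
theorem eq_zero_of_mem_primitiveSpace_of_finrank_le (L : HasLefschetzProperty h e) {k : ℕ} (hk : Module.finrank K M ≤ k) {p : M}
    (hp : p ∈ primitiveSpace h e k) : p = 0 := by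
  have hbot := L.degreeSpace_eq_bot (n := -(k : ℤ)) (by rw [abs_neg, Nat.abs_cast]; exact_mod_cast hk)
  have h1 := (mem_primitiveSpace_iff.1 hp).1
  rwa [hbot, Submodule.mem_bot] at h1

/-- **The Hodge involution `⋆` of Kleiman (1968, 1.4.2) = Milne's `∗` (1999, p. 664: "`*x = Σ (-1)^{(s-2i)(s-2i+1)/2} L^{d-s+i} xᵢ`")**:
`⋆ = *_L ∘ J`, the constructed Lefschetz involution of g29-#2 followed by the sign `(-1)^{i(i+1)/2}` on the strings through the
primitive classes of degree `i = d - k` (`J = hodgeSign e *_L d (dim M)`).  André's `*_H` (1996, §1.1) is this operator RESCALED by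
`j!/(k-j)!` on the strings (`HasLefschetzProperty.andreHodgeInvolution`, file `LefschetzModuleWeylOperator.lean`; see the ERRATUM in the
module docstring) — the name `hodgeInvolution` is kept for the factorial-free `⋆ = ∗`.
[cite: Kleiman1968AlgebraicCycles, §1.4, 1.4.2] [cite: Milne1999LefschetzClasses, §5 p. 664] [cite: Andre1996Motifs, §1.1 (p. 10, "involutions de Lefschetz et de Hodge", up to the factor k!/(d-j+k)!)] -/
def hodgeInvolution (L : HasLefschetzProperty h e) (hgr : IsZGrading h) (d : ℕ) : Module.End K M :=
  L.lefschetzInvolution hgr * hodgeSign e (L.lefschetzInvolution hgr) d (Module.finrank K M)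

/-- **THE PRINTED FORMULA on a string: `*_H (eʲ p) = (-1)^{(d-k)(d-k+1)/2} e^{k-j} p`** for `p ∈ P_{-k}`, `j ≤ k` (André's
`*_H (Lʳ x_i) = (-1)^{i(i+1)/2} L^{d-i-r} x_i`, `i = d - k`; Milne's `∗(Lⁱ xᵢ) = (-1)^{(s-2i)(s-2i+1)/2} L^{d-s+i} xᵢ`).
[cite: Andre1996Motifs, §1.1 (p. 10)] [cite: Milne1999LefschetzClasses, §5 p. 664] [cite: Kleiman1968AlgebraicCycles, §1.4, 1.4.2] -/
theorem hodgeInvolution_apply_pow_primitive (L : HasLefschetzProperty h e) (hgr : IsZGrading h) (d : ℕ) {k : ℕ} {p : M}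
    (hp : p ∈ primitiveSpace h e k) {j : ℕ} (hj : j ≤ k) :
    L.hodgeInvolution hgr d ((e ^ j) p) = ((-1 : K) ^ ((d - k) * (d - k + 1) / 2)) • (e ^ (k - j)) p := by
  by_cases hk : Module.finrank K M ≤ k
  · rw [L.eq_zero_of_mem_primitiveSpace_of_finrank_le hk hp, map_zero, map_zero, map_zero, smul_zero]
  rw [hodgeInvolution, Module.End.mul_apply,
    (L.isStringReversal_lefschetzInvolution hgr).hodgeSign_apply_pow_primitive d (le_of_lt (not_le.1 hk)) hp hj, map_smul,
    L.isStringReversal_lefschetzInvolution hgr hp hj]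

/-- On a primitive vector: `*_H p = (-1)^{(d-k)(d-k+1)/2} eᵏ p` (`*_H x_i = (-1)^{i(i+1)/2} L^{d-i} x_i`).
[cite: Andre1996Motifs, §1.1 (p. 10)] [cite: Kleiman1968AlgebraicCycles, §1.4, 1.4.2] -/
theorem hodgeInvolution_apply_primitive (L : HasLefschetzProperty h e) (hgr : IsZGrading h) (d : ℕ) {k : ℕ} {p : M}
    (hp : p ∈ primitiveSpace h e k) :
    L.hodgeInvolution hgr d p = ((-1 : K) ^ ((d - k) * (d - k + 1) / 2)) • (e ^ k) p := by
  have h1 := L.hodgeInvolution_apply_pow_primitive hgr d hp (Nat.zero_le k) (j := 0)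
  rwa [pow_zero, Module.End.one_apply, Nat.sub_zero] at h1

/-- **`*_H` is an involution: `*_H ∘ *_H = 1`** (on a string: `eʲ p ↦ ε e^{k-j} p ↦ ε² eʲ p`).
[cite: Andre1996Motifs, §1.1 (p. 10, "involutions de Lefschetz et de Hodge")] -/
theorem hodgeInvolution_mul_self (L : HasLefschetzProperty h e) (hgr : IsZGrading h) (d : ℕ) :
    L.hodgeInvolution hgr d * L.hodgeInvolution hgr d = 1 := by
  refine L.linearMap_ext_of_strings hgr fun k p hp j hj ↦ ?_
  rw [Module.End.mul_apply, Module.End.one_apply, L.hodgeInvolution_apply_pow_primitive hgr d hp hj, map_smul,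
    L.hodgeInvolution_apply_pow_primitive hgr d hp (Nat.sub_le k j), smul_smul, neg_one_pow_mul_self, one_smul,
    show k - (k - j) = j by omega]

/-- `*_H (*_H x) = x`. [cite: Andre1996Motifs, §1.1 (p. 10)] -/
theorem hodgeInvolution_hodgeInvolution (L : HasLefschetzProperty h e) (hgr : IsZGrading h) (d : ℕ) (x : M) :
    L.hodgeInvolution hgr d (L.hodgeInvolution hgr d x) = x := by
  rw [← Module.End.mul_apply, L.hodgeInvolution_mul_self hgr d, Module.End.one_apply]

/-- **`⋆ L ⋆ = *_L L *_L`** (André's `ᶜL`; the OCR reading "`*_L L *_L = *_H L *_H`" of p. 11 is a definition `ᶜL := *_L L *_L`, see the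
ERRATUM — the identity below holds for `⋆`): conjugating `e` by the Hodge involution gives the same lowering operator `N` as conjugating by
the Lefschetz involution (on `eʲ p`, `j ≥ 1`: `ε · ε · e^{j-1} p`; `0` for `j = 0`). [cite: Andre1996Motifs, §1.1 (p. 11)] -/
theorem hodgeInvolution_mul_mul_hodgeInvolution_eq (L : HasLefschetzProperty h e) (hgr : IsZGrading h) (d : ℕ) :
    L.hodgeInvolution hgr d * e * L.hodgeInvolution hgr d =
      L.lefschetzInvolution hgr * e * L.lefschetzInvolution hgr := by
  refine L.linearMap_ext_of_strings hgr fun k p hp j hj ↦ ?_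
  rw [Module.End.mul_apply, Module.End.mul_apply,
    (L.isStringReversal_lefschetzInvolution hgr).conj_apply_pow_primitive hp hj,
    L.hodgeInvolution_apply_pow_primitive hgr d hp hj, map_smul, map_smul, ← Module.End.mul_apply e (e ^ (k - j)), ← pow_succ']
  by_cases hj0 : j = 0
  · subst hj0
    rw [if_pos rfl, Nat.sub_zero, (mem_primitiveSpace_iff.1 hp).2, map_zero, smul_zero]
  · rw [if_neg hj0, L.hodgeInvolution_apply_pow_primitive hgr d hp (show k - j + 1 ≤ k by omega), smul_smul,
      neg_one_pow_mul_self, one_smul, show k - (k - j + 1) = j - 1 by omega]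

omit [FiniteDimensional K M] in
/-- **"`ℚ[L, *_H] ⊆ ℚ[L, *_L]`" (Prop. 1.2) / "this algebra contains `∗`" (Milne): `*_H ∈ K[e, *_L]`.**
[cite: Andre1996Motifs, Prop. 1.2 (p. 11)] [cite: Milne1999LefschetzClasses, §5 Thm. 5.9 (proof, p. 665)] -/
theorem hodgeInvolution_mem_adjoin (L : HasLefschetzProperty h e) (hgr : IsZGrading h) (d : ℕ) :
    L.hodgeInvolution hgr d ∈ Algebra.adjoin K ({e, L.lefschetzInvolution hgr} : Set (Module.End K M)) := by
  have hs : L.lefschetzInvolution hgr ∈ Algebra.adjoin K ({e, L.lefschetzInvolution hgr} : Set (Module.End K M)) :=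
    Algebra.subset_adjoin (Set.mem_insert_of_mem _ rfl)
  have he : e ∈ Algebra.adjoin K ({e, L.lefschetzInvolution hgr} : Set (Module.End K M)) :=
    Algebra.subset_adjoin (Set.mem_insert _ _)
  refine Subalgebra.mul_mem _ hs (Algebra.adjoin_le ?_ (hodgeSign_mem_adjoin _ d _))
  rintro x (rfl | rfl)
  · exact he
  · exact Subalgebra.mul_mem _ (Subalgebra.mul_mem _ hs he) hs

omit [CharZero K] [FiniteDimensional K M] in
/-- `h` on a string vector: `h (eʲ p) = (2j - k) eʲ p` for `p ∈ P_{-k}`. [cite: LooijengaLunts1997, §1 (1.1) p. 3 L106–L111] -/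
theorem apply_pow_primitive_eq_smul (L : HasLefschetzProperty h e) {k : ℕ} {p : M} (hp : p ∈ primitiveSpace h e k) (j : ℕ) :
    h ((e ^ j) p) = ((-(k : ℤ) + 2 * j : ℤ) : K) • (e ^ j) p :=
  mem_degreeSpace_iff.1 (L.pow_apply_mem (mem_primitiveSpace_iff.1 hp).1 j)

/-- **`*_H` reverses the grading: `h *_H = - *_H h`.** [cite: Andre1996Motifs, §1.1 (p. 10)] [cite: Milne1999LefschetzClasses, §5 p. 664 (∗ : Hˢ → H^{2d-s})] -/
theorem mul_hodgeInvolution_eq_neg (L : HasLefschetzProperty h e) (hgr : IsZGrading h) (d : ℕ) :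
    h * L.hodgeInvolution hgr d = -(L.hodgeInvolution hgr d * h) := by
  refine L.linearMap_ext_of_strings hgr fun k p hp j hj ↦ ?_
  rw [Module.End.mul_apply, LinearMap.neg_apply, Module.End.mul_apply, L.apply_pow_primitive_eq_smul hp j, map_smul,
    L.hodgeInvolution_apply_pow_primitive hgr d hp hj, map_smul, L.apply_pow_primitive_eq_smul hp (k - j), smul_comm,
    ← neg_smul]
  congr 1
  rw [← Int.cast_neg]
  congr 1
  push_cast [Nat.cast_sub hj]
  ring

/-- `*_H` maps `M_m` into `M_{-m}` (`Hˢ → H^{2d-s}`). [cite: Milne1999LefschetzClasses, §5 p. 664] [cite: Andre1996Motifs, §1.1 (p. 10)] -/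
theorem hodgeInvolution_apply_mem (L : HasLefschetzProperty h e) (hgr : IsZGrading h) (d : ℕ) {m : ℤ} {x : M}
    (hx : x ∈ degreeSpace h m) : L.hodgeInvolution hgr d x ∈ degreeSpace h (-m) := by
  rw [mem_degreeSpace_iff] at hx ⊢
  have h1 := LinearMap.congr_fun (L.mul_hodgeInvolution_eq_neg hgr d) x
  rw [Module.End.mul_apply, LinearMap.neg_apply, Module.End.mul_apply, hx, map_smul] at h1
  rw [h1, Int.cast_neg, neg_smul]

omit [CharZero K] [FiniteDimensional K M] in
/-- An operator commuting with `e` and with `s` commutes with every element of `K[e, s]`. [cite: Milne1999LefschetzClasses, §5 Thm. 5.9 (proof: "all elements of the ℚ-algebra ℚ[L, Λ]")] -/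
theorem commute_of_mem_adjoin_pair {u s x : Module.End K M} (hue : Commute u e) (hus : Commute u s)
    (hx : x ∈ Algebra.adjoin K ({e, s} : Set (Module.End K M))) : Commute u x := by
  have hle : Algebra.adjoin K ({e, s} : Set (Module.End K M)) ≤ Subalgebra.centralizer K {u} := by
    refine Algebra.adjoin_le ?_
    rintro y (rfl | rfl)
    · exact Set.mem_centralizer_iff.2 fun v hv ↦ by rw [Set.mem_singleton_iff.1 hv]; exact hue.eq
    · exact Set.mem_centralizer_iff.2 fun v hv ↦ by rw [Set.mem_singleton_iff.1 hv]; exact hus.eq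
  exact (Set.mem_centralizer_iff.1 (hle hx) u (Set.mem_singleton u))

omit [FiniteDimensional K M] in
/-- **Milne's Thm. 5.9 mechanism for `∗`: an operator commuting with `h` and `e` commutes with `*_H`** (it commutes with `*_L`,
g29-#2, hence with the whole algebra `K[e, *_L] ∋ *_H`). [cite: Milne1999LefschetzClasses, §5 Thm. 5.9 (proof, p. 665)] -/
theorem commute_hodgeInvolution (L : HasLefschetzProperty h e) (hgr : IsZGrading h) (d : ℕ) {u : Module.End K M}
    (huh : Commute u h) (hue : Commute u e) : Commute u (L.hodgeInvolution hgr d) :=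
  commute_of_mem_adjoin_pair hue (L.commute_lefschetzInvolution hgr huh hue) (L.hodgeInvolution_mem_adjoin hgr d)

/-- `ᶜΛ ∈ K[e, *_H e *_H]` ("`ℚ[L, *_H L *_H] = ℚ[L, ᶜΛ]`", the inclusion `⊇`, through "`*_L L *_L = *_H L *_H`").
[cite: Andre1996Motifs, Prop. 1.2 (p. 11)] [cite: Kleiman1968AlgebraicCycles, §1.4, 1.4.4] -/
theorem dual_mem_adjoin_hodgeInvolution_conj (L : HasLefschetzProperty h e) (hgr : IsZGrading h) (d : ℕ) :
    L.dual hgr ∈ Algebra.adjoin K ({e, L.hodgeInvolution hgr d * e * L.hodgeInvolution hgr d} : Set (Module.End K M)) := by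
  rw [L.hodgeInvolution_mul_mul_hodgeInvolution_eq hgr d]
  exact L.dual_mem_adjoin_conj_lefschetzInvolution hgr

/-- The primitive part through `*_H`: `P_{-k} = M_{-k} ∩ ker(*_H e *_H)`. [cite: Andre1996Motifs, §1.1 (p. 11)] -/
theorem primitiveSpace_eq_inf_ker_conj_hodgeInvolution (L : HasLefschetzProperty h e) (hgr : IsZGrading h) (d k : ℕ) :
    primitiveSpace h e k = degreeSpace h (-(k : ℤ)) ⊓
      LinearMap.ker (L.hodgeInvolution hgr d * e * L.hodgeInvolution hgr d) := by
  rw [L.hodgeInvolution_mul_mul_hodgeInvolution_eq hgr d]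
  exact L.primitiveSpace_eq_inf_ker_conj_lefschetzInvolution hgr k

/-! ### André's Prop. 1.2, second algebra: `K[e, *_L] = K[e, *_H]` (appended, row g29-#7) -/

/-- **The sign operator is an involution: `J² = 1`** (`J = ±1` on every string, and the strings span `M`).
[cite: Andre1996Motifs, §1.1 (p. 10)] -/
theorem hodgeSign_lefschetzInvolution_mul_self (L : HasLefschetzProperty h e) (hgr : IsZGrading h) (d : ℕ) :
    hodgeSign e (L.lefschetzInvolution hgr) d (Module.finrank K M) * hodgeSign e (L.lefschetzInvolution hgr) d (Module.finrank K M) =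
      1 := by
  refine L.linearMap_ext_of_strings hgr fun k p hp j hj ↦ ?_
  by_cases hk : Module.finrank K M ≤ k
  · rw [L.eq_zero_of_mem_primitiveSpace_of_finrank_le hk hp, map_zero, map_zero, map_zero]
  rw [Module.End.mul_apply, Module.End.one_apply,
    (L.isStringReversal_lefschetzInvolution hgr).hodgeSign_apply_pow_primitive d (le_of_lt (not_le.1 hk)) hp hj, map_smul,
    (L.isStringReversal_lefschetzInvolution hgr).hodgeSign_apply_pow_primitive d (le_of_lt (not_le.1 hk)) hp hj, smul_smul,
    neg_one_pow_mul_self, one_smul]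

/-- **`*_L = *_H J`** (from `*_H = *_L J` and `J² = 1`). [cite: Andre1996Motifs, §1.1 (p. 10)] -/
theorem lefschetzInvolution_eq_hodgeInvolution_mul_hodgeSign (L : HasLefschetzProperty h e) (hgr : IsZGrading h) (d : ℕ) :
    L.lefschetzInvolution hgr = L.hodgeInvolution hgr d * hodgeSign e (L.lefschetzInvolution hgr) d (Module.finrank K M) := by
  rw [hodgeInvolution, mul_assoc, L.hodgeSign_lefschetzInvolution_mul_self hgr d, mul_one]

/-- **"`ℚ[L, *_L] ⊆ ℚ[L, *_H]`": `*_L ∈ K[e, *_H]`** — `*_L = *_H J` with `J ∈ K[e, *_L e *_L] = K[e, *_H e *_H] ⊆ K[e, *_H]`.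
[cite: Andre1996Motifs, Prop. 1.2 (p. 11)] -/
theorem lefschetzInvolution_mem_adjoin_hodgeInvolution (L : HasLefschetzProperty h e) (hgr : IsZGrading h) (d : ℕ) :
    L.lefschetzInvolution hgr ∈ Algebra.adjoin K ({e, L.hodgeInvolution hgr d} : Set (Module.End K M)) := by
  have hH : L.hodgeInvolution hgr d ∈ Algebra.adjoin K ({e, L.hodgeInvolution hgr d} : Set (Module.End K M)) :=
    Algebra.subset_adjoin (Set.mem_insert_of_mem _ rfl)
  have he : e ∈ Algebra.adjoin K ({e, L.hodgeInvolution hgr d} : Set (Module.End K M)) :=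
    Algebra.subset_adjoin (Set.mem_insert _ _)
  rw [L.lefschetzInvolution_eq_hodgeInvolution_mul_hodgeSign hgr d]
  refine Subalgebra.mul_mem _ hH (Algebra.adjoin_le ?_ (hodgeSign_mem_adjoin _ d _))
  rintro x (rfl | rfl)
  · exact he
  · rw [SetLike.mem_coe, ← L.hodgeInvolution_mul_mul_hodgeInvolution_eq hgr d]
    exact Subalgebra.mul_mem _ (Subalgebra.mul_mem _ hH he) hH

/-- **ANDRÉ 1996, PROP. 1.2 (the first two algebras): `K[e, *_L] = K[e, *_H]`** as subalgebras of `End_K(M)` ("Les sous-algèbres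
`Q_ν[L, *_L]`, `Q_ν[L, *_H]`, […] de `End H(X)` sont égales"). [cite: Andre1996Motifs, Prop. 1.2 (p. 11)] -/
theorem adjoin_pair_lefschetzInvolution_eq_adjoin_pair_hodgeInvolution (L : HasLefschetzProperty h e) (hgr : IsZGrading h) (d : ℕ) :
    Algebra.adjoin K ({e, L.lefschetzInvolution hgr} : Set (Module.End K M)) =
      Algebra.adjoin K ({e, L.hodgeInvolution hgr d} : Set (Module.End K M)) := by
  refine le_antisymm (Algebra.adjoin_le ?_) (Algebra.adjoin_le ?_)
  · rintro x (rfl | rfl)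
    · exact Algebra.subset_adjoin (Set.mem_insert _ _)
    · exact L.lefschetzInvolution_mem_adjoin_hodgeInvolution hgr d
  · rintro x (rfl | rfl)
    · exact Algebra.subset_adjoin (Set.mem_insert _ _)
    · exact L.hodgeInvolution_mem_adjoin hgr d

/-- **`K[e, *_H e *_H] ⊆ K[e, *_H]` contains the dual `f = Λ`** ("Q[L, Λ]" ⊆ "Q[L, *_H]"; Milne: "this algebra contains `ᶜΛ` and `∗`", read
backwards). [cite: Andre1996Motifs, Prop. 1.2 (p. 11)] [cite: Milne1999LefschetzClasses, §5 Thm. 5.9 (proof, p. 665)] -/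
theorem dual_mem_adjoin_hodgeInvolution (L : HasLefschetzProperty h e) (hgr : IsZGrading h) (d : ℕ) :
    L.dual hgr ∈ Algebra.adjoin K ({e, L.hodgeInvolution hgr d} : Set (Module.End K M)) := by
  rw [← L.adjoin_pair_lefschetzInvolution_eq_adjoin_pair_hodgeInvolution hgr d]
  exact L.dual_mem_adjoin_lefschetzInvolution hgr

/-- **Every operator commuting with `e` and `*_H` commutes with all of `K[e, *_L] = K[e, *_H]`** (`∋ *_L`, `Λ`, `ᶜΛ`).
[cite: Andre1996Motifs, Prop. 1.2 (p. 11)] [cite: Milne1999LefschetzClasses, §5 Thm. 5.9 (proof, p. 665)] -/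
theorem commute_of_commute_hodgeInvolution (L : HasLefschetzProperty h e) (hgr : IsZGrading h) (d : ℕ) {u x : Module.End K M}
    (hue : Commute u e) (huH : Commute u (L.hodgeInvolution hgr d))
    (hx : x ∈ Algebra.adjoin K ({e, L.lefschetzInvolution hgr} : Set (Module.End K M))) : Commute u x := by
  rw [L.adjoin_pair_lefschetzInvolution_eq_adjoin_pair_hodgeInvolution hgr d] at hx
  exact commute_of_mem_adjoin_pair hue huH hx

end HasLefschetzProperty

end Literature.Algebra.Lie

end
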